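import Summits.ResolutionOfSingularities.ResolutionOfSingularities.Theorems.FrobeniusLadderFInjectiveMacaulayficationRoadBFrameMod
import Summits.ResolutionOfSingularities.ResolutionOfSingularities.Theorems.FrobeniusLadderFInjectiveMacaulayficationT11OriginPointFixableOfCells
import HarnessLib

/-!
# The road-B `T₁₁ / p` frame over TRUNCATED cells (crux `FInjectiveMacaulayfication`, road B at `p ≥ 11`)

[OURS · L1 W4.5a] Support file for crux stmt-ResolutionOfSingularities-15315 (res-L1-w45a-plan-1 R13.36 (2); res-L1-w45a-stub-3's
frame-glue status line 2026-08-27T15:48:50Z: «needs ONE file … the T₁₁ wrappers with the binder swapped»; author res-D-pv-018 AS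
res-L1-w45a-stub-6).  This is res-L1-w45a-stub-2's `T11OriginPointFixableOfCells` §2/§3 (`t11_originPointFixable_of_cells`,
`fInjectiveMacaulayfication_T11plus_of_cells`) VERBATIM except that the cells binder is WEAKENED to the truncated form `hcellsMod` of
`KLocCellMod` (split identity modulo `(Y_i^p : i ∈ S)`; produced per chart by `KLocCellKit.klocCellsMod_of_check'`, p542226, in
≈ 90 s/chart at `p = 11`, ≈ 250 s/chart at `p = 13`) and the frame is `RoadBFrameMod.originPointFixable_of_cellsMod`; `hg0`/`hX`
are stub-2's BY NAME.  So a `T₁₁/p` campaign for `p ∉ {2, 3, 7}` = 18 generated `…T11Char<p>Cells<NN>` files (truncated cells) +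
one `cells_all` + `fInjectiveMacaulayfication_T11plus_of_cellsMod p … cells_all`.  Pure glue; no definition; AI-written, weaker than
expert review; the certificate mathematics is res-L1-w45a-tri-1's; no statement of [claim: Hironaka2017] is used. [folklore]
-/

-- single-problem summit: the doubled namespace component is forced
set_option linter.dupNamespace false

noncomputable section

namespace Summit.ResolutionOfSingularities.ResolutionOfSingularities.Theorems.FInjectiveMacaulayfication.T11OriginPointFixableOfCellsMod

open MvPolynomial AlgebraicGeometry
open Summit.ResolutionOfSingularities.ResolutionOfSingularities.Theorems.FInjectiveMacaulayfication

/-- **THE ROAD-B INSTANCE `T₁₁ / p` MODULO THE TRUNCATED CELL PACKAGES**, every prime `p ≠ 3`: given the 87 per-chart TRUNCATED cell packages at `p` (`KLocCellMod`'s `hcellsMod`: split identity only modulo `(Y_i^p : i ∈ S)`, as produced by `KLocCellKit.klocCellsMod_of_check'`) over the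
tables `T11Char7Poly.G` / `T11Char7Poly.SS` (the `cells_all` theorem of a campaign's instance file), the origin of
`X = Spec k[x,y,z,w]/(z² + (y²+x³)³ + x¹¹ + w⁷)`, `char k = p`, is point-fixable (`PFix_p`, the `h0` shape of the specimen doors).
[OURS; folklore glue] -/
theorem t11_originPointFixable_of_cellsMod (p : ℕ) [Fact p.Prime] (hp3 : p ≠ 3) (k : Type) [Field k] [CharP k p]
    (Gs : Fin 1 → MvPolynomial (Fin 4) k) (hG : Gs 0 = X 2 ^ 2 + (X 1 ^ 2 + X 0 ^ 3) ^ 3 + X 0 ^ 11 + X 3 ^ 7)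
    (hcellsMod : ∀ (c : Fin 87), ∀ S ∈ T11Char7Poly.SS c,
      ∃ (L : List ((Fin 4 →₀ ℕ) × MvPolynomial (Fin 4) k)) (rr : List (MvPolynomial (Fin 4) k))
        (tt : Fin 4 → MvPolynomial (Fin 4) k) (t₀ : MvPolynomial (Fin 4) k),
        (L.map Prod.fst).Nodup ∧ (∀ e ∈ L, ∀ i : Fin 4, e.1 i < p) ∧
        KLocCellKit.evalL k (T11Char7Poly.G c) ^ (p - 1) - (L.map fun e => MvPolynomial.monomial e.1 (1 : k) * MvPolynomial.expand p e.2).sum ∈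
          Ideal.span ((fun i : Fin 4 => (MvPolynomial.X i : MvPolynomial (Fin 4) k) ^ p) '' (S : Set (Fin 4))) ∧
        (1 : MvPolynomial (Fin 4) k) = (List.zipWith (fun r e => r * MvPolynomial.expand p e.2) rr L).sum +
          ∑ i ∈ S, tt i * MvPolynomial.X i + t₀ * KLocCellKit.evalL k (T11Char7Poly.G c)) :
    ∀ b : Spec (.of (MvPolynomial (Fin 4) k ⧸ Ideal.span (Set.range Gs))),
      b.asIdeal = Ideal.span (Set.range fun j : Fin 4 => Ideal.Quotient.mk (Ideal.span (Set.range Gs)) (X j)) →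
      ∃ (nc : ℕ) (c : Fin nc → (Spec (.of (MvPolynomial (Fin 4) k ⧸ Ideal.span (Set.range Gs)))).presheaf.stalk b),
        Ideal.span (Set.range c) ≠ ⊥ ∧ (Ideal.span (Set.range c)).radical =
          IsLocalRing.maximalIdeal ((Spec (.of (MvPolynomial (Fin 4) k ⧸ Ideal.span (Set.range Gs)))).presheaf.stalk b) ∧
        ∀ (j : Fin nc) (𝔔 : PrimeSpectrum (Literature.AlgebraicGeometry.Resolution.blowupAlgebra (Ideal.span (Set.range c)) (c j))),
          𝔔.asIdeal.comap (algebraMap ((Spec (.of (MvPolynomial (Fin 4) k ⧸ Ideal.span (Set.range Gs)))).presheaf.stalk b)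
            (Literature.AlgebraicGeometry.Resolution.blowupAlgebra (Ideal.span (Set.range c)) (c j))) =
            IsLocalRing.maximalIdeal ((Spec (.of (MvPolynomial (Fin 4) k ⧸ Ideal.span (Set.range Gs)))).presheaf.stalk b) →
          IsDomain (Localization.AtPrime 𝔔.asIdeal) ∧ ∀ dd : ℕ, ringKrullDim (Localization.AtPrime 𝔔.asIdeal) = dd →
            ∀ s : Fin dd → Localization.AtPrime 𝔔.asIdeal, (Ideal.span (Set.range s)).radical.IsMaximal →
              RingTheory.Sequence.IsWeaklyRegular (Localization.AtPrime 𝔔.asIdeal) (List.ofFn s) ∧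
              ∀ y : Localization.AtPrime 𝔔.asIdeal, (∃ e : ℕ, y ^ p ^ e ∈ Ideal.span
                ((fun z : Localization.AtPrime 𝔔.asIdeal => z ^ p ^ e) '' (Ideal.span (Set.range s) : Set (Localization.AtPrime 𝔔.asIdeal)))) →
                y ∈ Ideal.span (Set.range s) := by
  -- `Gs = ![T₁₁]`, then substitute
  have e : Gs = ![X 2 ^ 2 + (X 1 ^ 2 + X 0 ^ 3) ^ 3 + X 0 ^ 11 + X 3 ^ 7] := by
    funext l
    fin_cases l
    exact hG
  subst e
  have hpr := T11HypersurfacePrime.t11_prime_and_X_ne_zero k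
    (![X 2 ^ 2 + (X 1 ^ 2 + X 0 ^ 3) ^ 3 + X 0 ^ 11 + X 3 ^ 7] : Fin 1 → MvPolynomial (Fin 4) k) rfl
  have hf0 : constantCoeff (X 2 ^ 2 + (X 1 ^ 2 + X 0 ^ 3) ^ 3 + X 0 ^ 11 + X 3 ^ 7 : MvPolynomial (Fin 4) k) = 0 := by
    simp [constantCoeff_X]
  exact RoadBFrameMod.originPointFixable_of_cellsMod p k 4 87 T11Char7Fan.ht T11Char7Fan.A T11Char7Fan.hAJ T11Char7Fan.hprim
    T11Char7Fan.m (T11Char7Fan.hcov k) T11Char7Fan.V T11Char7Fan.hV T11Char7Fan.a T11Char7Fan.haA T11Char7Fan.hgen T11Char7Fan.hge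
    (X 2 ^ 2 + (X 1 ^ 2 + X 0 ^ 3) ^ 3 + X 0 ^ 11 + X 3 ^ 7) hf0 hpr.1 hpr.2 T11Char7Poly.G T11Char7Fan.d (T11Char7Poly.hθF₀ k)
    T11Char7Fan.hunit (T11Char7Fan.hzero k _) (T11OriginPointFixableOfCells.hg0 p hp3 k) (T11OriginPointFixableOfCells.hX p hp3 k) T11Char7Poly.SS T11Char7Poly.hSScov hcellsMod

/-! ## §3 The crux conclusion for `T₁₁⁺` modulo the cell packages, `p ∉ {2, 3, 7}` -/

/-- **THE CRUX STATEMENT FOR `X = T₁₁⁺` OVER EVERY FIELD OF CHARACTERISTIC `p ∉ {2, 3, 7}`, MODULO THE 87 TRUNCATED CELL PACKAGES AT `p`.**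
`T₁₁⁺ = V(Φ − y² − x³, z² + Φ³ + x¹¹ + w⁷) ⊂ 𝔸⁵_k` has an F-injective Macaulayfication in the sense of the crux
`FrobeniusLadder.FInjectiveMacaulayfication` as soon as the 87 kernel cell checks at `p` are supplied (`hcells` = a campaign's `cells_all`):
door `T11SpecimenDoorWide.fInjectiveMacaulayfication_T11plus_of_ne` ∘ stalk transport `T11PlusOriginTransportStalk.t11Plus_h0_of_hypersurface_h0` ∘
`t11_originPointFixable_of_cellsMod` (frame `RoadBFrameMod.originPointFixable_of_cellsMod`). [OURS · L1 W4.5a; AI-built, weaker than expert review; the certificate mathematics is res-L1-w45a-tri-1's] -/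
theorem fInjectiveMacaulayfication_T11plus_of_cellsMod (p : ℕ) [Fact p.Prime] (hp2 : p ≠ 2) (hp3 : p ≠ 3) (hp7 : p ≠ 7)
    (k : Type) [Field k] [CharP k p] (Fs : Fin 2 → MvPolynomial (Fin 5) k)
    (hF₀ : Fs 0 = X 4 - X 1 ^ 2 - X 0 ^ 3) (hF₁ : Fs 1 = X 2 ^ 2 + X 4 ^ 3 + X 0 ^ 11 + X 3 ^ 7)
    (hcellsMod : ∀ (c : Fin 87), ∀ S ∈ T11Char7Poly.SS c,
      ∃ (L : List ((Fin 4 →₀ ℕ) × MvPolynomial (Fin 4) k)) (rr : List (MvPolynomial (Fin 4) k))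
        (tt : Fin 4 → MvPolynomial (Fin 4) k) (t₀ : MvPolynomial (Fin 4) k),
        (L.map Prod.fst).Nodup ∧ (∀ e ∈ L, ∀ i : Fin 4, e.1 i < p) ∧
        KLocCellKit.evalL k (T11Char7Poly.G c) ^ (p - 1) - (L.map fun e => MvPolynomial.monomial e.1 (1 : k) * MvPolynomial.expand p e.2).sum ∈
          Ideal.span ((fun i : Fin 4 => (MvPolynomial.X i : MvPolynomial (Fin 4) k) ^ p) '' (S : Set (Fin 4))) ∧
        (1 : MvPolynomial (Fin 4) k) = (List.zipWith (fun r e => r * MvPolynomial.expand p e.2) rr L).sum +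
          ∑ i ∈ S, tt i * MvPolynomial.X i + t₀ * KLocCellKit.evalL k (T11Char7Poly.G c)) :
    ∃ (X' : Scheme.{0}) (π : X' ⟶ (Spec (.of (MvPolynomial (Fin 5) k ⧸ Ideal.span (Set.range Fs))))),
      IsProper π ∧ Literature.AlgebraicGeometry.Resolution.IsBirational π ∧
      ∀ x : X', IsDomain (X'.presheaf.stalk x) ∧ ∀ d : ℕ, ringKrullDim (X'.presheaf.stalk x) = d →
        ∀ s : Fin d → X'.presheaf.stalk x, (Ideal.span (Set.range s)).radical.IsMaximal →
          RingTheory.Sequence.IsWeaklyRegular (X'.presheaf.stalk x) (List.ofFn s) ∧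
          ∀ y : X'.presheaf.stalk x, (∃ e : ℕ, y ^ p ^ e ∈ Ideal.span
            ((fun z : X'.presheaf.stalk x => z ^ p ^ e) '' (Ideal.span (Set.range s) : Set (X'.presheaf.stalk x)))) →
            y ∈ Ideal.span (Set.range s) := by
  haveI : (Ideal.span (Set.range fun j : Fin 4 => Ideal.Quotient.mk (Ideal.span (Set.range
      (![X 2 ^ 2 + (X 1 ^ 2 + X 0 ^ 3) ^ 3 + X 0 ^ 11 + X 3 ^ 7] : Fin 1 → MvPolynomial (Fin 4) k))) (MvPolynomial.X j))).IsPrime :=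
    (QuotientOriginMaximal.isMaximal_span_range_mk_X k
      (![X 2 ^ 2 + (X 1 ^ 2 + X 0 ^ 3) ^ 3 + X 0 ^ 11 + X 3 ^ 7] : Fin 1 → MvPolynomial (Fin 4) k)
      (fun l => by fin_cases l; simp [constantCoeff_X])).isPrime
  exact T11SpecimenDoorWide.fInjectiveMacaulayfication_T11plus_of_ne p hp2 hp3 hp7 k Fs hF₀ hF₁
    (T11PlusOriginTransportStalk.t11Plus_h0_of_hypersurface_h0 k p Fs hF₀ hF₁
      (![X 2 ^ 2 + (X 1 ^ 2 + X 0 ^ 3) ^ 3 + X 0 ^ 11 + X 3 ^ 7] : Fin 1 → MvPolynomial (Fin 4) k) rfl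
      (t11_originPointFixable_of_cellsMod p hp3 k _ rfl hcellsMod))

end Summit.ResolutionOfSingularities.ResolutionOfSingularities.Theorems.FInjectiveMacaulayfication.T11OriginPointFixableOfCellsMod

end
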